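import Mathlib
import HarnessLib.Audit
import Summits.PneNP.PneNP.Theorems.PstarGateNodesX
import Summits.PneNP.PneNP.Theorems.PstarGateFibre
import Summits.PneNP.PneNP.Theorems.PstarGateCaseTCycle

/-!
# One GATED chord, node N5: the COUPLING of the two fundamental cycles on the gate chamber (E2; prover-1 g19)

FRONTIER range-avoidance ladder, rung F-N3 (`stmt-PneNP-19007`), cell `pnp-ideate` (`PstarGateNodesX.GateU2X`); restricted-model proof complexity —
nothing here bears on `P` versus `NP`.

`N = {e, e'}`, `e` gated, `e'` doubly read.  Separation on the gate chamber `H₁ = {x_u = κ₀ + 1}` (`PstarGateFibre.sep_of_U2`: where the gated chord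
is killable the companion chord is not) feeds `PstarGateFibre.fibre_dichotomy_of_sep`; with `PstarGateCaseTCycle.card_symmDiff_le_two`:

* `u2_sep` — ∀ x with `x_u = κ₀ + 1`: `u_e(x) = 0 → u_{e'}(x) ≠ 0`;
* `u2_coupling` — if `Q_{D e}` and `Q_{D e'}` both keep rank `≥ 4` on `coordKer {u}`: EITHER **`κ₀ = 1`, every edge of `D e ∆ D e'` passes through
  `u`, and `#(D e ∆ D e') ≤ 2`** (the EQ coupling: the two cycles differ by at most two `u`-edges), OR the (EXC) coupling
  `Q_{D e ∆ D e'} = ν₁ν₂ + κ` on the chamber.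
-/

set_option linter.dupNamespace false -- `Summit.PneNP.PneNP.…`: summit = sub-problem name (D-0017 single-conjunct layout)

open Finset Module Literature.Computability.Complexity
open scoped symmDiff
open Summit.PneNP.PneNP.Theorems.PstarTyped (Typed)
open Summit.PneNP.PneNP.Theorems.PstarSALevel (BoundaryExpanding SimpleOverlap)
open Summit.PneNP.PneNP.Theorems.PstarCubeIdeals (IsAffineFn)
open Summit.PneNP.PneNP.Theorems.PstarProductRank (qform polar)
open Summit.PneNP.PneNP.Theorems.PstarQuadRank (rad)
open Summit.PneNP.PneNP.Theorems.PstarPathRankFibre (coordKer)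
open Summit.PneNP.PneNP.Theorems.PstarReadSumset (V2)
open Summit.PneNP.PneNP.Theorems.PstarChordSystem (ChordSystem)
open Summit.PneNP.PneNP.Theorems.PstarChordBridgeTools (privs coef)
open Summit.PneNP.PneNP.Theorems.PstarChordBridge (BridgeData sys Solution Lift)
open Summit.PneNP.PneNP.Theorems.PstarGateBridge (GateHyp)
open Summit.PneNP.PneNP.Theorems.PstarGateFibre (sep_of_U2 fibre_dichotomy_of_sep)
open Summit.PneNP.PneNP.Theorems.PstarGateCaseTCycle (card_symmDiff_le_two)
open Summit.PneNP.PneNP.Theorems.PstarGateNodes (GateData)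
open Summit.PneNP.PneNP.Theorems.PstarGateNodesX (GateDataX)

namespace Summit.PneNP.PneNP.Theorems.PstarGateU2Coupling

variable {n m : ℕ}

/-- **Separation on the gate chamber**: where `x_u = κ₀ + 1` (the gate reads) and the gated chord is killable, the companion chord is ON. -/
theorem u2_sep (I : LocalMap 4 n m) (hI : I.IsPure xorAndPred) (hT : Typed I) {r₀ : ℕ} {B : BridgeData n m} {e g₀ : Fin m} {u : Fin n}
    {κ₀ : ZMod 2} (hD : GateDataX I r₀ B e g₀ u κ₀) {e' : Fin m} (hN : B.N = {e, e'}) (hne : e' ≠ e)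
    (hU2 : ∀ a, (sys I B).ρ e' a ≠ 0 ∧ (sys I B).ρ' e' a ≠ 0 ∧ (sys I B).ρ e' a ≠ (sys I B).ρ' e' a) :
    ∀ x : Fin n → ZMod 2, x u = κ₀ + 1 → (sys I B).u e x = 0 → (sys I B).u e' x ≠ 0 := by
  obtain ⟨-, hW, -, -, -, hL, -, -, hG, -, -, -, -, -, -, hcoef, hT3, -⟩ := id hD
  intro x hxu hue
  have he' : e' ∈ B.N := by rw [hN]; exact mem_insert_of_mem (mem_singleton_self _)
  obtain ⟨h1, h2, h12⟩ := hU2 x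
  have hl : coef I B.C₁ B.G₁ (I.vars e 2) x = 1 := by
    rw [hcoef, hxu]
    have e2 : ∀ k : ZMod 2, k + (k + 1) = 1 := by decide
    exact e2 κ₀
  exact sep_of_U2 I hI hT hW hL hG hT3 he' hne h1 h2 h12 hl hue

/-- **The coupling dichotomy.**  With both fundamental forms of rank `≥ 4` on the chamber: EQ coupling (`κ₀ = 1`, `D e ∆ D e'` consists of at most two
`u`-edges) or EXC coupling on the chamber. -/
theorem u2_coupling (I : LocalMap 4 n m) (hI : I.IsPure xorAndPred) (hT : Typed I) (hS : SimpleOverlap I) {r₀ : ℕ} {B : BridgeData n m}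
    {e g₀ : Fin m} {u : Fin n} {κ₀ : ZMod 2} (hD : GateDataX I r₀ B e g₀ u κ₀) {e' : Fin m} (hN : B.N = {e, e'}) (hne : e' ≠ e)
    (hU2 : ∀ a, (sys I B).ρ e' a ≠ 0 ∧ (sys I B).ρ' e' a ≠ 0 ∧ (sys I B).ρ e' a ≠ (sys I B).ρ' e' a)
    (hrD : finrank (ZMod 2) (rad ((polar (B.D e) (fun j => I.vars j 2) (fun j => I.vars j 3)).restrict (coordKer ({u} : Finset (Fin n))))) + 4 ≤
      finrank (ZMod 2) (coordKer ({u} : Finset (Fin n))))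
    (hrD' : finrank (ZMod 2) (rad ((polar (B.D e') (fun j => I.vars j 2) (fun j => I.vars j 3)).restrict (coordKer ({u} : Finset (Fin n))))) + 4 ≤
      finrank (ZMod 2) (coordKer ({u} : Finset (Fin n)))) :
    (κ₀ = 1 ∧ (∀ j ∈ B.D e ∆ B.D e', I.vars j 2 = u ∨ I.vars j 3 = u) ∧ (B.D e ∆ B.D e').card ≤ 2) ∨
    (∃ ν₁ ν₂ : coordKer ({u} : Finset (Fin n)) → ZMod 2, IsAffineFn ν₁ ∧ IsAffineFn ν₂ ∧ ∃ κ : ZMod 2,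
      ∀ w : coordKer ({u} : Finset (Fin n)),
        qform (B.D e ∆ B.D e') (fun j => I.vars j 2) (fun j => I.vars j 3) ((Pi.single u (κ₀ + 1) : Fin n → ZMod 2) + (w : Fin n → ZMod 2)) =
          ν₁ w * ν₂ w + κ) := by
  classical
  obtain ⟨-, hW, -, -, -, -, -, -, hG, -⟩ := id hD
  have he : e ∈ B.N := hG.1
  have he' : e' ∈ B.N := by rw [hN]; exact mem_insert_of_mem (mem_singleton_self _)
  have hsep := u2_sep I hI hT hD hN hne hU2
  rcases fibre_dichotomy_of_sep I hI hS hW he he' hne hsep hrD hrD' with ⟨hc, hthrough⟩ | hEXC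
  · left
    have hκ : κ₀ = 1 := by
      have e2 : ∀ k : ZMod 2, k + 1 = 0 → k = 1 := by decide
      exact e2 κ₀ hc
    have heD : e ∉ B.D e := fun h => (mem_sdiff.1 (hW.hD e he h)).2 he
    have he'D : e' ∉ B.D e' := fun h => (mem_sdiff.1 (hW.hD e' he' h)).2 he'
    exact ⟨hκ, hthrough, card_symmDiff_le_two I hI hS heD he'D (hW.hDeven e he) (hW.hDeven e' he') hthrough⟩
  · exact Or.inr hEXC

end Summit.PneNP.PneNP.Theorems.PstarGateU2Coupling
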